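import Mathlib
import HarnessLib
import Summits.HubbardSuperconductivity.HubbardSuperconductivity.Theorems.KLProgrammeKLRegimeEngineTwoLegCellReader
import Summits.HubbardSuperconductivity.HubbardSuperconductivity.Theorems.KLProgrammeKLRegimeSectorSliceCharSumMoment

/-!
# Route `KLProgramme` — crux K3 ENGINE (stmt-HubbardSuperconductivity-20437 `KLRegimeEngineV17F2`), row (b), E1 docket item (2) «(E2)-CELL-READER», part 3:
# the input-family two-leg cell from ORDER-THREE SYMBOL DATA per partner sector (reader ∘ p3's `sliceCharSumWt_l1_le_of_data`)

Cell `gate-hubbard-kl`, seat hubbard-kl-k3c2-p3 (g19).  Sequel of `…EngineTwoLegCellReader` (part 2).  Composing the reader with the per-pair weighted master bound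
`…SectorSliceCharSumMoment.sliceCharSumWt_l1_le_of_data` (p3 g9; `c₀ = 1`, multiplier `M = F_{J,ω}·F_{J,ω′}`, profile `Ψ = g_{τ(q)}`) at the FORCED weight rates
`s₀ = Λ_Jβ/(2M)` (time; `s₀·2M = Λ_Jβ`) and `s₁ = Λ_J` (axes), free frame rates `s₂, s₃` on an integer frame `(v⊥, v)`:

* **`klWtPinnedSumOf_two_le_of_symbolData`** — `klWtPinnedSumOf L M β μ K J 2 T q w ≤ ε_x·Σ_{ℓ′} √(32768(1/s₀+1)[C_w²·4(…)(…) + 16(1/s₁+1)²/(1+s₁R₀)])·√(21·2M·L²·N_s(ℓ′))·A₀(ℓ′)`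
  from, per partner label `ℓ′`: the support count `N_s(ℓ′)` of `F_{J,ω}F_{J,ω′}`, the sup `A₀(ℓ′)` of the pair symbol and its THIRD single-direction differences in the five
  directions (time `(4/(Λ_Jβ))³`, axes `(4/(Λ_JL))³`, `v⊥` `(4/(s₂L))³`, `v` `(4/(s₃L))³`) — by discrete Leibniz (`norm_fwdDiff_iter_three_smul_mul_le_of_support`) these are
  multiplier data (p4 lineage) plus the sup and three scaled differences of the two-leg symbol `g_τ = Ŵ₂` on the `3`-neighbourhood of each partner support: THE E1-FACING FACE
  of (E2).  With the scales of the thin family (`A₀ ≍ sup_{supp}|Ŵ₂|`, `N_s ≍ 2M·L²·Λ_J²2^{−J}·β`, `s₂|v| ≍ Λ_J`, `s₃|v| ≍ 2^{−J}`) the right side is `≍ βL²·sup_{supp}|Ŵ₂|` per partner,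
  i.e. the cell is the supremum of the two-leg symbol ON THE SHELL in the units of the plain line — `(U²·i)·Λ_i ≍ cc·4^{−i}`, the `s₂c·cc` term of the (E2) budget.

Everything is proved; no definitions, no named facts; nothing here asserts (E2), any engine row, K3 or superconductivity. [folklore]
References: BGM 2006 Lemma 2.2 (2.52), §2.8 (2.76), (2.81) [cite: BenfattoGiulianiMastropietro2006]; Disertori–Rivasseau, CMP 215 (2000) 251, App. A Lemma 12.
-/

noncomputable section

namespace Summit.HubbardSuperconductivity.HubbardSuperconductivity.Theorems.TorusFourierL2

set_option linter.dupNamespace false -- summit = problem name (single-conjunct summit), D-0017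

open Finset Complex Literature.Probability.LatticeModels Literature.MathematicalPhysics.QuantumLattice
open Literature.MathematicalPhysics.QuantumLattice.GrassmannAlgebra
open Summit.HubbardSuperconductivity.HubbardSuperconductivity.Theorems.KLRegimeSplit
open Summit.HubbardSuperconductivity.HubbardSuperconductivity.Theorems.KLProgrammeLegKernels
open Summit.HubbardSuperconductivity.HubbardSuperconductivity.Theorems.EngineV8
open scoped Real ComplexConjugate

variable {L M : ℕ} [NeZero L] [NeZero M]

/-! ### §5 The E1-facing data form: the cell from ORDER-THREE symbol data per partner sector -/

/-- **THE INPUT-FAMILY TWO-LEG CELL FROM ORDER-THREE SYMBOL DATA** (reader ∘ `sliceCharSumWt_l1_le_of_data`, pair by pair).  At family `F_J`, weight scale `J`,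
rates `s₀ = Λ_Jβ/(2M)` (time; `s₀·2M = Λ_Jβ`), `s₁ = Λ_J` (axes), free normal/tangential rates `s₂, s₃ > 0` on an integer frame `(v⊥, v)`, near radius `R₀`:
if for every partner label `ℓ′` the pair symbol `G_{ℓ′} = 1·((F_{J,ω}·F_{J,ω′})·g_{τ(q)})` has multiplier support `≤ N_s(ℓ′)`, sup `≤ A₀(ℓ′)` and third single-direction
differences `≤ A₀(ℓ′)·(4/(rate·period))³` in the five directions, then
`klWtPinnedSumOf L M β μ K J 2 T q w ≤ ε_x·Σ_{ℓ′} √(32768(1/s₀+1)[C_w²·4(…)(…) + 16(1/s₁+1)²/(1+s₁R₀)])·√(21·2M·L²·N_s(ℓ′))·A₀(ℓ′)`.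
The symbol data of the two-leg kernel enter only on the supports of the partner multiplier products (discrete Leibniz `norm_fwdDiff_iter_three_smul_mul_le_of_support`).
[cite: BenfattoGiulianiMastropietro2006, Lemma 2.2 (2.52), §2.8 (2.76), (2.81)] -/
theorem klWtPinnedSumOf_two_le_of_symbolData {β : ℝ} (hβ : 0 < β) (μ : ℝ) (K : TrigPolyC4v) (J : ℕ) (T : HubbardGrassmann L M)
    (g : (Fin 2 → Fin 2 × Fin 2) → TorusSite 1 (2 * M) × TorusSite 2 L → ℂ)
    (hker : ∀ (τ : Fin 2 → Fin 2 × Fin 2) (k : Fin 2 → FreqMomentum L M), kernel ℂ T 2 (fun i => ((k i, (τ i).1), (τ i).2)) =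
      if ((fun _ : Fin 1 => (((k 0).1 : ℕ) : ZMod (2 * M))), (k 0).2) = (((fun _ : Fin 1 => (((k 1).1 : ℕ) : ZMod (2 * M))), (k 1).2) : TorusSite 1 (2 * M) × TorusSite 2 L)
      then g τ ((fun _ : Fin 1 => (((k 0).1 : ℕ) : ZMod (2 * M))), (k 0).2) else 0)
    (hanom : ∀ τ : Fin 2 → Fin 2 × Fin 2, (τ 0).2 = (τ 1).2 → g τ = 0)
    (q : Fin 2) (w : SpaceTimeIdx L M × SectorLeg (sectorCount J))
    (v : Fin 2 → ℤ) (hv : v ≠ 0) {s₂ s₃ : ℝ} (hs₂ : 0 < s₂) (hs₃ : 0 < s₃) {R₀ : ℕ} (hR₀ : 2 * (|v 0| + |v 1|) * (R₀ : ℤ) < L)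
    (Ns : SectorLeg (sectorCount J) → ℕ) (A₀ : SectorLeg (sectorCount J) → ℝ) (hA₀ : ∀ ℓ', 0 ≤ A₀ ℓ')
    (hsupp : ∀ ℓ' : SectorLeg (sectorCount J), (univ.filter fun Q : TorusSite 1 (2 * M) × TorusSite 2 L =>
        klAnisoFamily L M β μ K klE0 J w.2.1.1 (⟨(Q.1 0).val, ZMod.val_lt (Q.1 0)⟩, Q.2) *
          klAnisoFamily L M β μ K klE0 J ℓ'.1.1 (⟨(Q.1 0).val, ZMod.val_lt (Q.1 0)⟩, Q.2) ≠ 0).card ≤ Ns ℓ')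
    (hsup : ∀ (ℓ' : SectorLeg (sectorCount J)) (Q : TorusSite 1 (2 * M) × TorusSite 2 L),
      ‖(1 : ℂ) * (klAnisoFamily L M β μ K klE0 J w.2.1.1 (⟨(Q.1 0).val, ZMod.val_lt (Q.1 0)⟩, Q.2) *
          klAnisoFamily L M β μ K klE0 J ℓ'.1.1 (⟨(Q.1 0).val, ZMod.val_lt (Q.1 0)⟩, Q.2) *
        g (fun i => if i = q then (w.2.1.2, w.2.2) else (ℓ'.1.2, ℓ'.2)) Q)‖ ≤ A₀ ℓ')
    (h₀ : ∀ (ℓ' : SectorLeg (sectorCount J)) (Q : TorusSite 1 (2 * M) × TorusSite 2 L),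
      ‖(fwdDiff ((fun _ : Fin 1 => (1 : ZMod (2 * M))), (0 : TorusSite 2 L)))^[3]
        (fun y : TorusSite 1 (2 * M) × TorusSite 2 L => (1 : ℂ) * (klAnisoFamily L M β μ K klE0 J w.2.1.1 (⟨(y.1 0).val, ZMod.val_lt (y.1 0)⟩, y.2) *
            klAnisoFamily L M β μ K klE0 J ℓ'.1.1 (⟨(y.1 0).val, ZMod.val_lt (y.1 0)⟩, y.2) *
          g (fun i => if i = q then (w.2.1.2, w.2.2) else (ℓ'.1.2, ℓ'.2)) y)) Q‖ ≤ A₀ ℓ' * (4 / (klScale klE0 J * β)) ^ 3)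
    (h₁ : ∀ (ℓ' : SectorLeg (sectorCount J)) (Q : TorusSite 1 (2 * M) × TorusSite 2 L) (i : Fin 2),
      ‖(fwdDiff ((0 : TorusSite 1 (2 * M)), (Pi.single i (1 : ZMod L) : TorusSite 2 L)))^[3]
        (fun y : TorusSite 1 (2 * M) × TorusSite 2 L => (1 : ℂ) * (klAnisoFamily L M β μ K klE0 J w.2.1.1 (⟨(y.1 0).val, ZMod.val_lt (y.1 0)⟩, y.2) *
            klAnisoFamily L M β μ K klE0 J ℓ'.1.1 (⟨(y.1 0).val, ZMod.val_lt (y.1 0)⟩, y.2) *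
          g (fun i => if i = q then (w.2.1.2, w.2.2) else (ℓ'.1.2, ℓ'.2)) y)) Q‖ ≤ A₀ ℓ' * (4 / (klScale klE0 J * L)) ^ 3)
    (h₂ : ∀ (ℓ' : SectorLeg (sectorCount J)) (Q : TorusSite 1 (2 * M) × TorusSite 2 L),
      ‖(fwdDiff ((0 : TorusSite 1 (2 * M)), (fun j => ((![-v 1, v 0] j : ℤ) : ZMod L))))^[3]
        (fun y : TorusSite 1 (2 * M) × TorusSite 2 L => (1 : ℂ) * (klAnisoFamily L M β μ K klE0 J w.2.1.1 (⟨(y.1 0).val, ZMod.val_lt (y.1 0)⟩, y.2) *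
            klAnisoFamily L M β μ K klE0 J ℓ'.1.1 (⟨(y.1 0).val, ZMod.val_lt (y.1 0)⟩, y.2) *
          g (fun i => if i = q then (w.2.1.2, w.2.2) else (ℓ'.1.2, ℓ'.2)) y)) Q‖ ≤ A₀ ℓ' * (4 / (s₂ * L)) ^ 3)
    (h₃ : ∀ (ℓ' : SectorLeg (sectorCount J)) (Q : TorusSite 1 (2 * M) × TorusSite 2 L),
      ‖(fwdDiff ((0 : TorusSite 1 (2 * M)), (fun j => ((v j : ℤ) : ZMod L))))^[3]
        (fun y : TorusSite 1 (2 * M) × TorusSite 2 L => (1 : ℂ) * (klAnisoFamily L M β μ K klE0 J w.2.1.1 (⟨(y.1 0).val, ZMod.val_lt (y.1 0)⟩, y.2) *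
            klAnisoFamily L M β μ K klE0 J ℓ'.1.1 (⟨(y.1 0).val, ZMod.val_lt (y.1 0)⟩, y.2) *
          g (fun i => if i = q then (w.2.1.2, w.2.2) else (ℓ'.1.2, ℓ'.2)) y)) Q‖ ≤ A₀ ℓ' * (4 / (s₃ * L)) ^ 3) :
    klWtPinnedSumOf L M β μ K J 2 T q w ≤
      imagTimeWeight β M * ∑ ℓ' : SectorLeg (sectorCount J),
        Real.sqrt (32768 * (1 / (klScale klE0 J * β / (2 * M)) + 1) *
            ((1 + 2 * Real.sqrt 2 * klScale klE0 J / (s₂ * Real.sqrt ((v 0 : ℝ) ^ 2 + (v 1 : ℝ) ^ 2)) +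
                2 * Real.sqrt 2 * klScale klE0 J / (s₃ * Real.sqrt ((v 0 : ℝ) ^ 2 + (v 1 : ℝ) ^ 2))) ^ 2 *
              (4 * ((2 * Real.sqrt 2 / (s₂ * Real.sqrt ((v 0 : ℝ) ^ 2 + (v 1 : ℝ) ^ 2)) + 2) *
                (2 * Real.sqrt 2 / (s₃ * Real.sqrt ((v 0 : ℝ) ^ 2 + (v 1 : ℝ) ^ 2)) + 2)))
              + 16 * (1 / klScale klE0 J + 1) ^ 2 / (1 + klScale klE0 J * R₀))) *
          Real.sqrt (21 * ((2 * M : ℕ) : ℝ) * (L : ℝ) ^ 2 * Ns ℓ') * A₀ ℓ' := by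
  haveI : NeZero (2 * M) := ⟨by have := NeZero.ne M; omega⟩
  have hΛ : 0 < klScale klE0 J := klth_klScale_pos J
  have hM0 : (0 : ℝ) < M := by exact_mod_cast Nat.pos_of_ne_zero (NeZero.ne M)
  have hs₀ : 0 < klScale klE0 J * β / (2 * M) := by positivity
  have hP : klScale klE0 J * β / (2 * M) * ((2 * M : ℕ) : ℝ) = klScale klE0 J * β := by
    push_cast; field_simp
  refine klWtPinnedSumOf_two_le_of_pairBounds hβ μ K J T g hker hanom q w _ fun ℓ' => ?_
  have h := sliceCharSumWt_l1_le_of_data (1 : ℂ)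
    (fun Q : TorusSite 1 (2 * M) × TorusSite 2 L => klAnisoFamily L M β μ K klE0 J w.2.1.1 (⟨(Q.1 0).val, ZMod.val_lt (Q.1 0)⟩, Q.2) *
      klAnisoFamily L M β μ K klE0 J ℓ'.1.1 (⟨(Q.1 0).val, ZMod.val_lt (Q.1 0)⟩, Q.2))
    (g (fun i => if i = q then (w.2.1.2, w.2.2) else (ℓ'.1.2, ℓ'.2))) v hv hs₀ hΛ hs₂ hs₃ hR₀ (hA₀ ℓ') (hsupp ℓ') (hsup ℓ')
    (fun Q => by rw [hP]; exact h₀ ℓ' Q) (h₁ ℓ') (h₂ ℓ') (h₃ ℓ')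
  simpa only [one_mul] using h

end Summit.HubbardSuperconductivity.HubbardSuperconductivity.Theorems.TorusFourierL2

end
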